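import Summits.BirchSwinnertonDyer.Rank1Residual.Additive.X4SemistableTwistRankZeroThreeClass
import Summits.BirchSwinnertonDyer.Rank1Residual.Additive.X4RankZeroCyclotomicThreeNoMilne
import Summits.BirchSwinnertonDyer.Rank1Residual.Additive.XMultRankZeroCyclotomicThreeX4NoMilneFacts
import Summits.BirchSwinnertonDyer.Rank1Residual.Additive.XSplitMultRankZeroCyclotomicThreeX4NoMilneFacts
import HarnessLib

/-!
# X4 ∧ semistable twist at `p = 3`, ranks `(0,0)`: the class theorems over `K = ℚ(ζ₃)` (lines V14b / V15 / V16 assembled) — Milne's A73 PROVED AWAY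
# (cell `b2b-bsdres`, team n1011, seat p16 GEN 11; lead R5-87 (e) (W2) = additive-p4 GEN 23 word: the
# UPPER / two-sided no-Milne twins of the additive-p4 ℚ(ζ₃) lines are the p16 lineage's; row T-MIL-CAN)

HONEST FRAMING (cell `b2b-bsdres`, run/shared/lean/b2b/bsd-rank1-residual/, verbatim in every
file): the goal of the cell is to DELETE the COMBINATION-SHAPED residual classes of the
Birch–Swinnerton-Dyer formula for ALL analytic-rank `≤ 1` elliptic curves over `ℚ` — "full BSD
formula for every rank `≤ 1` curve in class `C`" assembled STRICTLY from published theorems — so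
that the rank-`≤ 1` remainder becomes exactly the CONSTRUCTION-SHAPED classes, which are TYPED
(missing-input `Prop`s), NOT attempted. This is not "finishing BSD". Team n1011 (N10 / N11), seat p16:
research route; X1 / X3 / X4 / X10 / N10 / N11 labels and marks UNCHANGED; nothing booked. Theorems only.

This file is `X4SemistableTwistRankZeroThreeClass.lean` (mathematics, census and references in THAT file's docstrings,
unchanged) with the Milne binder `hMilne : Milne1972.bsdQuotient_baseChange_quadratic_anyModel` (A73)
DELETED from every Milne-binding theorem and NOTHING added: each such theorem is re-issued under its name
with the suffix `_noMilne`, every other binder and every proof line byte-identical, every call to a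
Milne-binding tree theorem redirected to its no-Milne twin (`…_noLocal` cores / `…_noMilne` Facts of the
p16 lineage); Milne-free helpers of the source file are used as landed, not re-declared. What the
additive-p4 cores read from A73 — `Ш(V_K)` finite and the `3`-adic valuation of the card identity over
`K = ℚ(ζ₃)` — are the THEOREMS `shaFinite_baseChange_of_twist` and T-MIL-CAN FILE 4
`padicVal_card_identity_baseChange[_anyRank]_of_natAbs_discr_eq` (`|d_K| = 3`, `V` good or multiplicative
at `3`: the per-place fibre identities (T) at EVERY place — n1011-p01's T-MIL-3 H-5a with rows T-MIL-B2 /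
T-A233 inside). Every other displayed hypothesis (named facts, (⊇/K) where present, census bits,
certificates) is exactly the source file's. Labels UNCHANGED; nothing booked; no mark moves.
-/

noncomputable section

open scoped Classical

open WeierstrassCurve Literature.NumberTheory.EllipticCurves
  Literature.NumberTheory.EllipticCurves.ModularForms
  Literature.NumberTheory.EllipticCurves.Rank1Residual
  Literature.NumberTheory.EllipticCurves.Rank1Residual.Typed
  Summit.BirchSwinnertonDyer.Rank1Residual.AdditivePotMult

namespace Summit.BirchSwinnertonDyer.Rank1Residual.Additive

variable (V : WeierstrassCurve ℚ) [V.IsElliptic] [V.IsGloballyMinimal]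
  (W : WeierstrassCurve ℚ) [W.IsElliptic] [W.IsGloballyMinimal]

/-- **X4 at `p = 3`, class level, ranks `(0,0)`: the sum inequality.** Let `(W, 3)` be an X4 pair
(`ClassX4 W 3`: `W[3]` irreducible, `W` additive at `3`, `W` globally minimal) with census bits
`surj(3)` (`ρ̄_{W,3}` onto) and `ram(3)` (a multiplicative prime `ℓ ≠ 3` of `W` with `3 ∤ v_ℓ(Δ)`), and `V`
a globally minimal curve with `C • V^{(−3)} = W` which is ORDINARY-SEMISTABLE at `3`
(`IsOrdinaryAt V 3 ∨ Mult V 3`), both of analytic rank `0`. Then `#Ш_an(V) = q_V`, `#Ш_an(W) = q_W`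
are rationals with **`ord₃ #Ш(V) + ord₃ #Ш(W) ≤ ord₃ q_V + ord₃ q_W`**, granted the named published facts
of lines V14b/V15/V16: Kato Astérisque 295 Thm. 17.4 (3) over `ℚ(ζ₃)` (`hKato`), Kato's divisibility as
attributed by Wuthrich 2014 Thm. 3 / Cor. 19 at a non-split / split multiplicative `3` (`hKatons`,
`hKatos`), Greenberg LNM 1716 Thm. 4.1 / pp. 112–113 over a number field (`hGr`, `hGrns`, `hGrs`),
Greenberg–Stevens for `V` (`hGS`, split case only), modularity (`hmod`,
`hmodD`), Gross–Zagier–Kolyvagin (`hGZK`); split / non-split decided internally.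
[cite: Kato2004Asterisque, Thm. 17.4 (3) (p. 273)] [cite: Wuthrich2014, Thm. 3 (p. 383) and Cor. 19 (pp. 398–399)]
[cite: GreenbergLNM1716, Thm. 4.1 (p. 102) and §4 pp. 112–113] [cite: Milne1972ArithmeticAV, §1 Thm. 1 and §2 (through DokchitserDokchitserAnnals2010, §2.1, proof of Thm. 8)] -/
theorem ClassX4.exists_padicVal_shaOrder_add_le_three_of_ordSemistableTwist_noMilne
    (hKato : Kato2004.charIdeal_dvd_padicLFunction_cyclotomicThree_of_surjective)
    (hKatons : Wuthrich2014.kato_charIdeal_dvd_nonsplitMultiplicative_cyclotomicThree_of_surjective)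
    (hKatos : Wuthrich2014.kato_charIdeal_dvd_splitMultiplicative_cyclotomicThree_of_surjective)
    (hGr : Greenberg1999.thm41_charValue_rankZero_numberField)
    (hGrns : Greenberg1999.thm41Analogue_charValue_rankZero_numberField)
    (hGrs : Greenberg1999.thm41Analogue_charValue_rankZero_split_baseChange)
    (hGS : greenberg_stevens V 3)
    (hGZK : rank_eq_analyticRank_of_analyticRank_le_one) (hmod : hasEntireLFunction_rat)
    (hmodD : nonempty_modularParametrizationData)
    (hX : ClassX4 W 3) (hsurj : Surj W 3) (hram : Ram W 3)
    (C : VariableChange ℚ) (hC : C • V.quadraticTwist (-(3 : ℚ)) = W)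
    (hsst : IsOrdinaryAt V 3 ∨ V.HasMultiplicativeReductionAtPrime 3)
    (hrV : V.analyticRank = 0) (hrW : W.analyticRank = 0) :
    ∃ qV qW : ℚ, shaAn V = (qV : ℂ) ∧ shaAn W = (qW : ℂ) ∧
      (padicValNat 3 V.shaOrder : ℤ) + padicValNat 3 W.shaOrder ≤ padicValRat 3 qV + padicValRat 3 qW := by
  have hadd : Addv W 3 := hX.2.1
  rcases hsst with hord | hmult
  · exact X4CyclotomicThree.exists_padicVal_shaOrder_add_le_of_surj_of_ram_noMilne V W hKato hGr hGZK hmod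
      hmodD C hC hord hsurj hram hadd hrV hrW
  · by_cases hsplit : V.HasSplitMultiplicativeReductionAtPrime 3
    · exact XSplitMultCyclotomicThree.exists_padicVal_shaOrder_add_le_of_facts_of_surj_of_ram_noMilne V W hKatos
        hGrs hGS hGZK hmod hmodD C hC hsplit hsurj hram hadd hrV hrW
    · exact XMultCyclotomicThree.exists_padicVal_shaOrder_add_le_of_facts_of_surj_of_ram_noMilne V W hKatons hGrns
        hGZK hmod hmodD C hC hmult hsplit hsurj hram hadd hrV hrW

/-- **X4 at `p = 3`, class level: the cell's typed UPPER half for the additive curve.** In the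
situation of `ClassX4.exists_padicVal_shaOrder_add_le_three_of_ordSemistableTwist_noMilne`, if `#Ш_an(V)` has
non-positive `3`-adic valuation then `Typed.MissingUpperBoundAt W 3`.
[cite: Kato2004Asterisque, Thm. 17.4 (3) (p. 273)] [cite: Wuthrich2014, Thm. 3 (p. 383) and Cor. 19 (pp. 398–399)]
[cite: GreenbergLNM1716, Thm. 4.1 (p. 102) and §4 pp. 112–113] -/
theorem ClassX4.missingUpperBoundAt_three_of_ordSemistableTwist_noMilne
    (hKato : Kato2004.charIdeal_dvd_padicLFunction_cyclotomicThree_of_surjective)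
    (hKatons : Wuthrich2014.kato_charIdeal_dvd_nonsplitMultiplicative_cyclotomicThree_of_surjective)
    (hKatos : Wuthrich2014.kato_charIdeal_dvd_splitMultiplicative_cyclotomicThree_of_surjective)
    (hGr : Greenberg1999.thm41_charValue_rankZero_numberField)
    (hGrns : Greenberg1999.thm41Analogue_charValue_rankZero_numberField)
    (hGrs : Greenberg1999.thm41Analogue_charValue_rankZero_split_baseChange)
    (hGS : greenberg_stevens V 3)
    (hGZK : rank_eq_analyticRank_of_analyticRank_le_one) (hmod : hasEntireLFunction_rat)
    (hmodD : nonempty_modularParametrizationData)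
    (hX : ClassX4 W 3) (hsurj : Surj W 3) (hram : Ram W 3)
    (C : VariableChange ℚ) (hC : C • V.quadraticTwist (-(3 : ℚ)) = W)
    (hsst : IsOrdinaryAt V 3 ∨ V.HasMultiplicativeReductionAtPrime 3)
    (hrV : V.analyticRank = 0) (hrW : W.analyticRank = 0)
    {qV : ℚ} (hqV : shaAn V = (qV : ℂ)) (hv : padicValRat 3 qV ≤ 0) :
    MissingUpperBoundAt W 3 := by
  obtain ⟨qV', qW, hqV', hqW, hle⟩ := ClassX4.exists_padicVal_shaOrder_add_le_three_of_ordSemistableTwist_noMilne V W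
    hKato hKatons hKatos hGr hGrns hGrs hGS hGZK hmod hmodD hX hsurj hram C hC hsst hrV hrW
  have hqq : qV' = qV := by exact_mod_cast hqV'.symm.trans hqV
  subst hqq
  refine ⟨qW, hqW, ?_⟩
  have h0 : (0 : ℤ) ≤ padicValNat 3 V.shaOrder := by positivity
  linarith

/-- **X4 at `p = 3`, class level: `BSD(W,3) ∧ BSD(V,3)` on the doubly-unit rank-`(0,0)` rows.** In the
situation of `ClassX4.exists_padicVal_shaOrder_add_le_three_of_ordSemistableTwist_noMilne`, if `#Ш_an(V)` and
`#Ш_an(W)` are `3`-adic units then Miller's `BSD(W,3)` (the ADDITIVE X4 pair) and `BSD(V,3)` (its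
semistable big-image twist pair) hold simultaneously. Census (hyp cyc3 two-engine, `N < 2·10⁴`): 416 of
the 472 CORE-open rank-`(0,0)` X4 rows at `p = 3` with ordinary-semistable twist carry
`surj(3) ∧ ram(3)` and both unit bits. Labels UNCHANGED; nothing booked by this theorem.
[cite: Kato2004Asterisque, Thm. 17.4 (3) (p. 273)] [cite: Wuthrich2014, Thm. 3 (p. 383) and Cor. 19 (pp. 398–399)]
[cite: GreenbergLNM1716, Thm. 4.1 (p. 102) and §4 pp. 112–113] [cite: Miller2011LMS, §1 and Def. 1.1] -/
theorem ClassX4.bsdp_three_of_ordSemistableTwist_of_shaAn_units_noMilne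
    (hKato : Kato2004.charIdeal_dvd_padicLFunction_cyclotomicThree_of_surjective)
    (hKatons : Wuthrich2014.kato_charIdeal_dvd_nonsplitMultiplicative_cyclotomicThree_of_surjective)
    (hKatos : Wuthrich2014.kato_charIdeal_dvd_splitMultiplicative_cyclotomicThree_of_surjective)
    (hGr : Greenberg1999.thm41_charValue_rankZero_numberField)
    (hGrns : Greenberg1999.thm41Analogue_charValue_rankZero_numberField)
    (hGrs : Greenberg1999.thm41Analogue_charValue_rankZero_split_baseChange)
    (hGS : greenberg_stevens V 3)
    (hGZK : rank_eq_analyticRank_of_analyticRank_le_one) (hmod : hasEntireLFunction_rat)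
    (hmodD : nonempty_modularParametrizationData)
    (hX : ClassX4 W 3) (hsurj : Surj W 3) (hram : Ram W 3)
    (C : VariableChange ℚ) (hC : C • V.quadraticTwist (-(3 : ℚ)) = W)
    (hsst : IsOrdinaryAt V 3 ∨ V.HasMultiplicativeReductionAtPrime 3)
    (hrV : V.analyticRank = 0) (hrW : W.analyticRank = 0)
    {qV qW : ℚ} (hqV : shaAn V = (qV : ℂ)) (hqW : shaAn W = (qW : ℂ))
    (hvV : padicValRat 3 qV = 0) (hvW : padicValRat 3 qW = 0) : BSDp W 3 ∧ BSDp V 3 := by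
  obtain ⟨qV', qW', hqV', hqW', hle⟩ :=
    ClassX4.exists_padicVal_shaOrder_add_le_three_of_ordSemistableTwist_noMilne V W hKato hKatons hKatos hGr hGrns
      hGrs hGS hGZK hmod hmodD hX hsurj hram C hC hsst hrV hrW
  have hqq : qV' = qV := by exact_mod_cast hqV'.symm.trans hqV
  have hqq' : qW' = qW := by exact_mod_cast hqW'.symm.trans hqW
  subst hqq hqq'
  rw [hvV, hvW, add_zero] at hle
  have hV0 : (0 : ℤ) ≤ padicValNat 3 V.shaOrder := by positivity
  have hW0 : (0 : ℤ) ≤ padicValNat 3 W.shaOrder := by positivity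
  have huW : MissingUpperBoundAt W 3 := ⟨qW', hqW', by rw [hvW]; linarith⟩
  have huV : MissingUpperBoundAt V 3 := ⟨qV', hqV', by rw [hvV]; linarith⟩
  exact ⟨bsdp_of_missingPPartAt W 3 hGZK (by rw [hrW]; exact zero_le_one)
      (missingPPartAt_of_upper_of_shaAn_unit W 3 huW hqW' hvW),
    bsdp_of_missingPPartAt V 3 hGZK (by rw [hrV]; exact zero_le_one)
      (missingPPartAt_of_upper_of_shaAn_unit V 3 huV hqV' hvV)⟩

/-! ### The (M)-cell: `Mult V 3` is a theorem of additive-p1 (`ClassX4M.mult_of_twist_model_negThree`) -/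

/-- **X4(M) at `p = 3`, ranks `(0,0)`: the sum inequality with NO reduction datum on the twist.** For
`W` in additive-p1's class `ClassX4M W 3` (`ClassX4 W 3 ∧ v₃(j) < 0`) with `surj(3) ∧ ram(3)` and ANY
globally minimal `V` with `C • V^{(−3)} = W`, both of analytic rank `0`:
`ord₃ #Ш(V) + ord₃ #Ш(W) ≤ ord₃ #Ш_an(V) + ord₃ #Ш_an(W)` from the named facts of lines V15/V16.
[cite: Wuthrich2014, Thm. 3 (p. 383) and Cor. 19 (pp. 398–399)] [cite: GreenbergLNM1716, §4 pp. 112–113]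
[cite: SilvermanATAEC1994, V.5.3] -/
theorem ClassX4M.exists_padicVal_shaOrder_add_le_three_noMilne
    (hKatons : Wuthrich2014.kato_charIdeal_dvd_nonsplitMultiplicative_cyclotomicThree_of_surjective)
    (hKatos : Wuthrich2014.kato_charIdeal_dvd_splitMultiplicative_cyclotomicThree_of_surjective)
    (hGrns : Greenberg1999.thm41Analogue_charValue_rankZero_numberField)
    (hGrs : Greenberg1999.thm41Analogue_charValue_rankZero_split_baseChange)
    (hGS : greenberg_stevens V 3)
    (hGZK : rank_eq_analyticRank_of_analyticRank_le_one) (hmod : hasEntireLFunction_rat)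
    (hmodD : nonempty_modularParametrizationData)
    (hX : ClassX4M W 3) (hsurj : Surj W 3) (hram : Ram W 3)
    (C : VariableChange ℚ) (hC : C • V.quadraticTwist (-(3 : ℚ)) = W)
    (hrV : V.analyticRank = 0) (hrW : W.analyticRank = 0) :
    ∃ qV qW : ℚ, shaAn V = (qV : ℂ) ∧ shaAn W = (qW : ℂ) ∧
      (padicValNat 3 V.shaOrder : ℤ) + padicValNat 3 W.shaOrder ≤ padicValRat 3 qV + padicValRat 3 qW := by
  have hmult : V.HasMultiplicativeReductionAtPrime 3 := ClassX4M.mult_of_twist_model_negThree hX V C hC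
  have hadd : Addv W 3 := hX.1.2.1
  by_cases hsplit : V.HasSplitMultiplicativeReductionAtPrime 3
  · exact XSplitMultCyclotomicThree.exists_padicVal_shaOrder_add_le_of_facts_of_surj_of_ram_noMilne V W hKatos
      hGrs hGS hGZK hmod hmodD C hC hsplit hsurj hram hadd hrV hrW
  · exact XMultCyclotomicThree.exists_padicVal_shaOrder_add_le_of_facts_of_surj_of_ram_noMilne V W hKatons hGrns
      hGZK hmod hmodD C hC hmult hsplit hsurj hram hadd hrV hrW

/-- **X4(M) at `p = 3`: `BSD(W,3) ∧ BSD(V,3)` on the doubly-unit rank-`(0,0)` rows with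
`surj(3) ∧ ram(3)`**, class-level form of the V15/V16 X4 corollaries with the multiplicativity of the
twist discharged. Census (hyp cyc3, `N < 2·10⁴`): 191 + 169 = 360 of the 410 CORE-open rank-`(0,0)`
X4 ∧ (M) rows at `p = 3`. Labels UNCHANGED; nothing booked.
[cite: Wuthrich2014, Thm. 3 (p. 383) and Cor. 19 (pp. 398–399)] [cite: GreenbergLNM1716, §4 pp. 112–113]
[cite: Miller2011LMS, §1 and Def. 1.1] -/
theorem ClassX4M.bsdp_three_of_shaAn_units_noMilne
    (hKatons : Wuthrich2014.kato_charIdeal_dvd_nonsplitMultiplicative_cyclotomicThree_of_surjective)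
    (hKatos : Wuthrich2014.kato_charIdeal_dvd_splitMultiplicative_cyclotomicThree_of_surjective)
    (hGrns : Greenberg1999.thm41Analogue_charValue_rankZero_numberField)
    (hGrs : Greenberg1999.thm41Analogue_charValue_rankZero_split_baseChange)
    (hGS : greenberg_stevens V 3)
    (hGZK : rank_eq_analyticRank_of_analyticRank_le_one) (hmod : hasEntireLFunction_rat)
    (hmodD : nonempty_modularParametrizationData)
    (hX : ClassX4M W 3) (hsurj : Surj W 3) (hram : Ram W 3)
    (C : VariableChange ℚ) (hC : C • V.quadraticTwist (-(3 : ℚ)) = W)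
    (hrV : V.analyticRank = 0) (hrW : W.analyticRank = 0)
    {qV qW : ℚ} (hqV : shaAn V = (qV : ℂ)) (hqW : shaAn W = (qW : ℂ))
    (hvV : padicValRat 3 qV = 0) (hvW : padicValRat 3 qW = 0) : BSDp W 3 ∧ BSDp V 3 := by
  obtain ⟨qV', qW', hqV', hqW', hle⟩ :=
    ClassX4M.exists_padicVal_shaOrder_add_le_three_noMilne V W hKatons hKatos hGrns hGrs hGS hGZK hmod hmodD
      hX hsurj hram C hC hrV hrW
  have hqq : qV' = qV := by exact_mod_cast hqV'.symm.trans hqV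
  have hqq' : qW' = qW := by exact_mod_cast hqW'.symm.trans hqW
  subst hqq hqq'
  rw [hvV, hvW, add_zero] at hle
  have hV0 : (0 : ℤ) ≤ padicValNat 3 V.shaOrder := by positivity
  have hW0 : (0 : ℤ) ≤ padicValNat 3 W.shaOrder := by positivity
  have huW : MissingUpperBoundAt W 3 := ⟨qW', hqW', by rw [hvW]; linarith⟩
  have huV : MissingUpperBoundAt V 3 := ⟨qV', hqV', by rw [hvV]; linarith⟩
  exact ⟨bsdp_of_missingPPartAt W 3 hGZK (by rw [hrW]; exact zero_le_one)
      (missingPPartAt_of_upper_of_shaAn_unit W 3 huW hqW' hvW),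
    bsdp_of_missingPPartAt V 3 hGZK (by rw [hrV]; exact zero_le_one)
      (missingPPartAt_of_upper_of_shaAn_unit V 3 huV hqV' hvV)⟩

end Summit.BirchSwinnertonDyer.Rank1Residual.Additive

end
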